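import Summits.PneNP.PneNP.Theorems.ChebyshevTracialDesignAlignedDipolePeel
import HarnessLib

/-!
# Cell pnp-psdrank, route `ChebyshevTracialDesign`: aligned dipole families — the two-term recursion of their level
# sums and the tight level in closed form

Harmonic backbone of the `r = 1` rung of the crux `TracialDecayExp20` (stmt-PneNP-19878), eng g8, part 2 of 3.
An ALIGNED family for a perfect matching `M` of `S`: `κ` head pairs `x_j x'_j ∈ M` and `κ` tail pairs `y_j y'_j ∈ M`
(`2κ` distinct edges), and its dipole product `Φ_κ(U) = Π_{j<κ} (1[x_j∈U] − 1[y_j∈U])(1[x'_j∈U] − 1[y'_j∈U])` — the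
cut-side test vector of the Johnson layer `2κ` (Filmus' `χ_{A,B}` [cite: Filmus2016, Def. 2.2 (arXiv p. 4)] with
`A = (x_0, x'_0, x_1, …)`, `B = (y_0, y'_0, …)`), aligned with `M` so that its matching-side functional does not vanish.
* `aligned_level_sum_succ` — peeling the last pair (part 1): `Λ_{κ+1}(c,i) = 2·Λ_κ(c, i−1) − 2·Λ_κ(c−2, i)` on the instance
  with the four points and two edges removed (`Λ_κ(c,i) = Σ_{#cr = c, #in = i} Φ_κ`);
* `aligned_level_sum_tight` — at the tight level (`#cr = 1`) only the first branch survives: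
  `Λ_κ(1,l) = 2^κ · T(N−2κ; 1, l−κ)` (`T(m;a,b) = C(m,a+b)C(a+b,b)2^a` the level law of `…JuntaCount`), positive for `κ ≤ l`,
  `l + κ + 1 ≤ N` — the aligned matching is a legitimate reference column (cf. prover g6 `…LevelDifference`, whose closed
  form of (★) is this recursion iterated). [cite: Rothvoss2017, §2 (PDF p. 6)] [cite: GodsilMeagher2015, §15.2]
Stature: support/instrument. WHAT THIS IS NOT: no inequality yet (part 3), nothing on psd rank, no P-vs-NP content. No
definitions. Supports crux stmt-PneNP-19878.
-/

set_option linter.dupNamespace false -- `Summit.PneNP.PneNP.…`: summit = sub-problem (D-0017)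

namespace Summit.PneNP.PneNP.Theorems.ChebyshevTracialDesignAlignedDipoleRecursion

open Finset Literature.Barriers.PneNP Summit.PneNP.PneNP.Theorems.ChebyshevTracialDesignJunta
open Summit.PneNP.PneNP.Theorems.ChebyshevTracialDesignAlignedDipolePeel

variable {V : Type*} [DecidableEq V]

/-! ### §4 Aligned dipole families and the two-term recursion for their level sums -/

section Aligned

variable (x x' y y' : ℕ → V)

/-- **The two-term recursion.** Let `M` be a perfect matching of `S` containing the `2(κ+1)` pairwise distinct edges
`x_j x'_j` ("heads") and `y_j y'_j` ("tails"), `j ≤ κ`. Peeling the last pair: the sum of the aligned dipole product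
`Φ_{κ+1}(U) = Π_{j ≤ κ} (1[x_j∈U] − 1[y_j∈U])(1[x'_j∈U] − 1[y'_j∈U])` over the level class
`{U ⊆ S : #cr(U,M) = c, #in(U,M) = i}` equals `2·Σ' Φ_κ` over `{#cr' = c, #in' + 1 = i}` minus `2·Σ' Φ_κ` over
`{#cr' + 2 = c, #in' = i}` in the instance with the four points and two edges of pair `κ` removed. [folklore] -/
theorem aligned_level_sum_succ {S : Finset V} {M : Finset (Sym2 V)} (hM : IsPMOn S M) (κ : ℕ)
    (hx : ∀ j ≤ κ, s(x j, x' j) ∈ M) (hy : ∀ j ≤ κ, s(y j, y' j) ∈ M)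
    (hxinj : ∀ j ≤ κ, ∀ j' ≤ κ, s(x j, x' j) = s(x j', x' j') → j = j')
    (hyinj : ∀ j ≤ κ, ∀ j' ≤ κ, s(y j, y' j) = s(y j', y' j') → j = j')
    (hxy : ∀ j ≤ κ, ∀ j' ≤ κ, s(x j, x' j) ≠ s(y j', y' j')) (c i : ℕ) :
    ∑ U ∈ S.powerset.filter (fun U =>
        (M.filter fun e => cutCount U e = 1).card = c ∧ (M.filter fun e => cutCount U e = 2).card = i),
        ∏ j ∈ range (κ + 1), ((if x j ∈ U then (1 : ℝ) else 0) - (if y j ∈ U then (1 : ℝ) else 0)) *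
          ((if x' j ∈ U then (1 : ℝ) else 0) - (if y' j ∈ U then (1 : ℝ) else 0)) =
      2 * ∑ U ∈ (S \ {x κ, x' κ, y κ, y' κ}).powerset.filter (fun U =>
          ((M \ {s(x κ, x' κ), s(y κ, y' κ)}).filter fun e => cutCount U e = 1).card = c ∧
            1 + ((M \ {s(x κ, x' κ), s(y κ, y' κ)}).filter fun e => cutCount U e = 2).card = i),
        ∏ j ∈ range κ, ((if x j ∈ U then (1 : ℝ) else 0) - (if y j ∈ U then (1 : ℝ) else 0)) *
          ((if x' j ∈ U then (1 : ℝ) else 0) - (if y' j ∈ U then (1 : ℝ) else 0)) -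
      2 * ∑ U ∈ (S \ {x κ, x' κ, y κ, y' κ}).powerset.filter (fun U =>
          1 + (1 + ((M \ {s(x κ, x' κ), s(y κ, y' κ)}).filter fun e => cutCount U e = 1).card) = c ∧
            ((M \ {s(x κ, x' κ), s(y κ, y' κ)}).filter fun e => cutCount U e = 2).card = i),
        ∏ j ∈ range κ, ((if x j ∈ U then (1 : ℝ) else 0) - (if y j ∈ U then (1 : ℝ) else 0)) *
          ((if x' j ∈ U then (1 : ℝ) else 0) - (if y' j ∈ U then (1 : ℝ) else 0)) := by
  -- the last pair: four distinct points, two distinct edges of `M`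
  have hex : s(x κ, x' κ) ∈ M := hx κ le_rfl
  have hey : s(y κ, y' κ) ∈ M := hy κ le_rfl
  have hne : s(x κ, x' κ) ≠ s(y κ, y' κ) := hxy κ le_rfl κ le_rfl
  have hxx' : x κ ≠ x' κ := fun h => hM.not_isDiag hex (Sym2.mk_isDiag_iff.2 h)
  have hyy' : y κ ≠ y' κ := fun h => hM.not_isDiag hey (Sym2.mk_isDiag_iff.2 h)
  have hxy1 : x κ ≠ y κ := fun h => hne (hM.unique hex hey (Sym2.mem_mk_left _ _) (h ▸ Sym2.mem_mk_left _ _))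
  have hxy' : x κ ≠ y' κ := fun h => hne (hM.unique hex hey (Sym2.mem_mk_left _ _) (h ▸ Sym2.mem_mk_right _ _))
  have hx'y : x' κ ≠ y κ := fun h => hne (hM.unique hex hey (Sym2.mem_mk_right _ _) (h ▸ Sym2.mem_mk_left _ _))
  have hx'y' : x' κ ≠ y' κ :=
    fun h => hne (hM.unique hex hey (Sym2.mem_mk_right _ _) (h ▸ Sym2.mem_mk_right _ _))
  -- the decomposition `S = {x,x'} ∪ ({y,y'} ∪ S₃)`, `M = {xx'} ∪ ({yy'} ∪ M₃)`
  set S₃ : Finset V := S \ {x κ, x' κ, y κ, y' κ} with hS₃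
  set M₃ : Finset (Sym2 V) := M \ {s(x κ, x' κ), s(y κ, y' κ)} with hM₃
  have hQS : ({x κ, x' κ, y κ, y' κ} : Finset V) ⊆ S := by
    intro w hw
    simp only [mem_insert, mem_singleton] at hw
    rcases hw with rfl | rfl | rfl | rfl
    · exact hM.mem_of_mem hex (Sym2.mem_mk_left _ _)
    · exact hM.mem_of_mem hex (Sym2.mem_mk_right _ _)
    · exact hM.mem_of_mem hey (Sym2.mem_mk_left _ _)
    · exact hM.mem_of_mem hey (Sym2.mem_mk_right _ _)
  have hS : S = ({x κ, x' κ} : Finset V) ∪ (({y κ, y' κ} : Finset V) ∪ S₃) := by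
    rw [← union_assoc, hS₃]
    have : ({x κ, x' κ} : Finset V) ∪ {y κ, y' κ} = {x κ, x' κ, y κ, y' κ} := by
      ext w; simp only [mem_union, mem_insert, mem_singleton]; tauto
    rw [this, union_sdiff_of_subset hQS]
  have hMeq : M = ({s(x κ, x' κ)} : Finset (Sym2 V)) ∪ (({s(y κ, y' κ)} : Finset (Sym2 V)) ∪ M₃) := by
    rw [← union_assoc, hM₃]
    have : ({s(x κ, x' κ)} : Finset (Sym2 V)) ∪ {s(y κ, y' κ)} = {s(x κ, x' κ), s(y κ, y' κ)} := by
      ext e; simp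
    rw [this, union_sdiff_of_subset]
    intro e he
    simp only [mem_insert, mem_singleton] at he
    rcases he with rfl | rfl
    · exact hex
    · exact hey
  -- `M₃` is a perfect matching of `S₃`, in particular `M₃ ⊆ S₃.sym2`
  have hQM : IsPMOn ({x κ, x' κ, y κ, y' κ} : Finset V) {s(x κ, x' κ), s(y κ, y' κ)} := by
    have h1 := (IsPMOn.pair hxx').union (IsPMOn.pair hyy')
      (by simp [hxy1.symm, hxy'.symm, hx'y.symm, hx'y'.symm])
    have e1 : ({x κ, x' κ} : Finset V) ∪ {y κ, y' κ} = {x κ, x' κ, y κ, y' κ} := by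
      ext w; simp only [mem_union, mem_insert, mem_singleton]; tauto
    have e2 : ({s(x κ, x' κ)} : Finset (Sym2 V)) ∪ {s(y κ, y' κ)} = {s(x κ, x' κ), s(y κ, y' κ)} := by
      ext e; simp
    rwa [e1, e2] at h1
  have hM₃' : IsPMOn S₃ M₃ := by
    have h' : IsPMOn (({x κ, x' κ, y κ, y' κ} : Finset V) ∪ S₃) M := by rwa [hS₃, union_sdiff_of_subset hQS]
    have h3 := h'.sdiff disjoint_sdiff hQM (by
      intro e he
      simp only [mem_insert, mem_singleton] at he
      rcases he with rfl | rfl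
      · exact hex
      · exact hey)
    rwa [hM₃]
  have h₃ : M₃ ⊆ S₃.sym2 := hM₃'.1
  have hxS : x κ ∉ S₃ := by rw [hS₃]; simp
  have hx'S : x' κ ∉ S₃ := by rw [hS₃]; simp
  have hyS : y κ ∉ S₃ := by rw [hS₃]; simp
  have hy'S : y' κ ∉ S₃ := by rw [hS₃]; simp
  -- the weight `Φ_κ` is blind to the four points of pair `κ`
  have hpt : ∀ j < κ, x j ∉ ({x κ, x' κ, y κ, y' κ} : Finset V) ∧ x' j ∉ ({x κ, x' κ, y κ, y' κ} : Finset V) ∧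
      y j ∉ ({x κ, x' κ, y κ, y' κ} : Finset V) ∧ y' j ∉ ({x κ, x' κ, y κ, y' κ} : Finset V) := by
    intro j hj
    have hjx : s(x j, x' j) ≠ s(x κ, x' κ) := fun h => absurd (hxinj j hj.le κ le_rfl h) (by omega)
    have hjy : s(y j, y' j) ≠ s(y κ, y' κ) := fun h => absurd (hyinj j hj.le κ le_rfl h) (by omega)
    have hjxy : s(x j, x' j) ≠ s(y κ, y' κ) := hxy j hj.le κ le_rfl
    have hjyx : s(y j, y' j) ≠ s(x κ, x' κ) := fun h => hxy κ le_rfl j hj.le h.symm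
    have hexj : s(x j, x' j) ∈ M := hx j hj.le
    have heyj : s(y j, y' j) ∈ M := hy j hj.le
    -- a point of pair `j` inside the four points of pair `κ` would put it on two distinct edges of `M`
    have key : ∀ (w : V) (e : Sym2 V), e ∈ M → w ∈ e → e ≠ s(x κ, x' κ) → e ≠ s(y κ, y' κ) →
        w ∉ ({x κ, x' κ, y κ, y' κ} : Finset V) := by
      intro w e he hwe h1 h2 hw
      simp only [mem_insert, mem_singleton] at hw
      rcases hw with rfl | rfl | rfl | rfl
      · exact h1 (hM.unique he hex hwe (Sym2.mem_mk_left _ _))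
      · exact h1 (hM.unique he hex hwe (Sym2.mem_mk_right _ _))
      · exact h2 (hM.unique he hey hwe (Sym2.mem_mk_left _ _))
      · exact h2 (hM.unique he hey hwe (Sym2.mem_mk_right _ _))
    exact ⟨key _ _ hexj (Sym2.mem_mk_left _ _) hjx hjxy, key _ _ hexj (Sym2.mem_mk_right _ _) hjx hjxy,
      key _ _ heyj (Sym2.mem_mk_left _ _) hjyx hjy, key _ _ heyj (Sym2.mem_mk_right _ _) hjyx hjy⟩
  have hR : ∀ B U : Finset V, B ⊆ ({x κ, x' κ, y κ, y' κ} : Finset V) →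
      (∏ j ∈ range κ, ((if x j ∈ B ∪ U then (1 : ℝ) else 0) - (if y j ∈ B ∪ U then (1 : ℝ) else 0)) *
          ((if x' j ∈ B ∪ U then (1 : ℝ) else 0) - (if y' j ∈ B ∪ U then (1 : ℝ) else 0))) =
        ∏ j ∈ range κ, ((if x j ∈ U then (1 : ℝ) else 0) - (if y j ∈ U then (1 : ℝ) else 0)) *
          ((if x' j ∈ U then (1 : ℝ) else 0) - (if y' j ∈ U then (1 : ℝ) else 0)) := by
    intro B U hB
    refine prod_congr rfl fun j hj => ?_
    obtain ⟨h1, h2, h3, h4⟩ := hpt j (mem_range.1 hj)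
    have m1 : x j ∈ B ∪ U ↔ x j ∈ U := by
      rw [mem_union, or_iff_right]; exact fun h => h1 (hB h)
    have m2 : x' j ∈ B ∪ U ↔ x' j ∈ U := by
      rw [mem_union, or_iff_right]; exact fun h => h2 (hB h)
    have m3 : y j ∈ B ∪ U ↔ y j ∈ U := by
      rw [mem_union, or_iff_right]; exact fun h => h3 (hB h)
    have m4 : y' j ∈ B ∪ U ↔ y' j ∈ U := by
      rw [mem_union, or_iff_right]; exact fun h => h4 (hB h)
    simp only [m1, m2, m3, m4]
  -- peel
  have main := sum_pattern_pair_peel h₃ hxx' hxy1 hxy' hx'y hx'y' hyy' hxS hx'S hyS hy'S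
    (fun a b => a = c ∧ b = i)
    (fun U => ∏ j ∈ range κ, (((if x j ∈ U then (1 : ℝ) else 0) - (if y j ∈ U then (1 : ℝ) else 0)) *
      ((if x' j ∈ U then (1 : ℝ) else 0) - (if y' j ∈ U then (1 : ℝ) else 0)))) hR
  simp only [prod_range_succ]
  have hrw : ∀ U : Finset V,
      (∏ j ∈ range κ, ((if x j ∈ U then (1 : ℝ) else 0) - (if y j ∈ U then (1 : ℝ) else 0)) *
          ((if x' j ∈ U then (1 : ℝ) else 0) - (if y' j ∈ U then (1 : ℝ) else 0))) *
        (((if x κ ∈ U then (1 : ℝ) else 0) - (if y κ ∈ U then (1 : ℝ) else 0)) *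
          ((if x' κ ∈ U then (1 : ℝ) else 0) - (if y' κ ∈ U then (1 : ℝ) else 0))) =
      ((if x κ ∈ U then (1 : ℝ) else 0) - (if y κ ∈ U then (1 : ℝ) else 0)) *
          ((if x' κ ∈ U then (1 : ℝ) else 0) - (if y' κ ∈ U then (1 : ℝ) else 0)) *
        ∏ j ∈ range κ, ((if x j ∈ U then (1 : ℝ) else 0) - (if y j ∈ U then (1 : ℝ) else 0)) *
          ((if x' j ∈ U then (1 : ℝ) else 0) - (if y' j ∈ U then (1 : ℝ) else 0)) := fun U => by ring
  simp only [hrw]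
  rw [hS, hMeq]
  simpa only using main


/-- Restriction of an aligned family: after removing the last pair, the first `κ` pairs are aligned edges of the
reduced matching `M ∖ {x_κx'_κ, y_κy'_κ}`. [folklore] -/
theorem aligned_restrict {M : Finset (Sym2 V)} (κ : ℕ)
    (hx : ∀ j ≤ κ, s(x j, x' j) ∈ M) (hy : ∀ j ≤ κ, s(y j, y' j) ∈ M)
    (hxinj : ∀ j ≤ κ, ∀ j' ≤ κ, s(x j, x' j) = s(x j', x' j') → j = j')
    (hyinj : ∀ j ≤ κ, ∀ j' ≤ κ, s(y j, y' j) = s(y j', y' j') → j = j')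
    (hxy : ∀ j ≤ κ, ∀ j' ≤ κ, s(x j, x' j) ≠ s(y j', y' j')) :
    (∀ j < κ, s(x j, x' j) ∈ M \ {s(x κ, x' κ), s(y κ, y' κ)}) ∧
      (∀ j < κ, s(y j, y' j) ∈ M \ {s(x κ, x' κ), s(y κ, y' κ)}) := by
  refine ⟨fun j hj => mem_sdiff.2 ⟨hx j hj.le, ?_⟩, fun j hj => mem_sdiff.2 ⟨hy j hj.le, ?_⟩⟩
  · simp only [mem_insert, mem_singleton, not_or]
    exact ⟨fun h => absurd (hxinj j hj.le κ le_rfl h) (by omega), hxy j hj.le κ le_rfl⟩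
  · simp only [mem_insert, mem_singleton, not_or]
    exact ⟨fun h => hxy κ le_rfl j hj.le h.symm, fun h => absurd (hyinj j hj.le κ le_rfl h) (by omega)⟩

/-- Removing the two edges of the last pair lowers the number of edges by two. [folklore] -/
theorem card_sdiff_pair {M : Finset (Sym2 V)} (κ : ℕ) (hx : ∀ j ≤ κ, s(x j, x' j) ∈ M)
    (hy : ∀ j ≤ κ, s(y j, y' j) ∈ M) (hxy : ∀ j ≤ κ, ∀ j' ≤ κ, s(x j, x' j) ≠ s(y j', y' j')) :
    (M \ {s(x κ, x' κ), s(y κ, y' κ)}).card = M.card - 2 := by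
  rw [card_sdiff_of_subset]
  · rw [card_pair (hxy κ le_rfl κ le_rfl)]
  · intro e he
    simp only [mem_insert, mem_singleton] at he
    rcases he with rfl | rfl
    · exact hx κ le_rfl
    · exact hy κ le_rfl

/-- **The tight level in closed form.** For `M` a perfect matching of `S` with `N` edges containing the aligned family
of `κ` head pairs and `κ` tail pairs, and `κ ≤ l`, the sum of the aligned dipole product `Φ_κ` over the tight level
class `{U ⊆ S : #cr(U,M) = 1, #in(U,M) = l}` (cut size `t = 2l+1`) is
`2^κ · T(N − 2κ; 1, l − κ) = 2^κ · C(N−2κ, 1+l−κ) · C(1+l−κ, l−κ) · 2` — in particular it is POSITIVE as soon as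
`l + κ + 1 ≤ N`. [folklore] -/
theorem aligned_level_sum_tight : ∀ (κ : ℕ) {S : Finset V} {M : Finset (Sym2 V)}, IsPMOn S M →
    (∀ j < κ, s(x j, x' j) ∈ M) → (∀ j < κ, s(y j, y' j) ∈ M) →
    (∀ j < κ, ∀ j' < κ, s(x j, x' j) = s(x j', x' j') → j = j') →
    (∀ j < κ, ∀ j' < κ, s(y j, y' j) = s(y j', y' j') → j = j') →
    (∀ j < κ, ∀ j' < κ, s(x j, x' j) ≠ s(y j', y' j')) → ∀ l : ℕ, κ ≤ l →
    ∑ U ∈ S.powerset.filter (fun U =>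
        (M.filter fun e => cutCount U e = 1).card = 1 ∧ (M.filter fun e => cutCount U e = 2).card = l),
        ∏ j ∈ range κ, ((if x j ∈ U then (1 : ℝ) else 0) - (if y j ∈ U then (1 : ℝ) else 0)) *
          ((if x' j ∈ U then (1 : ℝ) else 0) - (if y' j ∈ U then (1 : ℝ) else 0)) =
      (2 : ℝ) ^ κ * (((M.card - 2 * κ).choose (1 + (l - κ)) * (1 + (l - κ)).choose (l - κ) * 2 ^ 1 : ℕ) : ℝ) := by
  intro κ
  induction κ with
  | zero =>
    intro S M hM _ _ _ _ _ l _
    simp only [range_zero, prod_empty, sum_const, nsmul_eq_mul, mul_one, pow_zero, one_mul, Nat.mul_zero,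
      Nat.sub_zero]
    rw [card_filter_cr_in_eq hM 1 l]
  | succ κ ih =>
    intro S M hM hx hy hxinj hyinj hxy l hκl
    have hx' : ∀ j ≤ κ, s(x j, x' j) ∈ M := fun j hj => hx j (Nat.lt_succ_of_le hj)
    have hy' : ∀ j ≤ κ, s(y j, y' j) ∈ M := fun j hj => hy j (Nat.lt_succ_of_le hj)
    have hxinj' : ∀ j ≤ κ, ∀ j' ≤ κ, s(x j, x' j) = s(x j', x' j') → j = j' :=
      fun j hj j' hj' => hxinj j (Nat.lt_succ_of_le hj) j' (Nat.lt_succ_of_le hj')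
    have hyinj' : ∀ j ≤ κ, ∀ j' ≤ κ, s(y j, y' j) = s(y j', y' j') → j = j' :=
      fun j hj j' hj' => hyinj j (Nat.lt_succ_of_le hj) j' (Nat.lt_succ_of_le hj')
    have hxy' : ∀ j ≤ κ, ∀ j' ≤ κ, s(x j, x' j) ≠ s(y j', y' j') :=
      fun j hj j' hj' => hxy j (Nat.lt_succ_of_le hj) j' (Nat.lt_succ_of_le hj')
    rw [aligned_level_sum_succ x x' y y' hM κ hx' hy' hxinj' hyinj' hxy' 1 l]
    -- the second sum is over the empty class `#cr' + 2 = 1`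
    have hempty : (S \ {x κ, x' κ, y κ, y' κ}).powerset.filter (fun U =>
        1 + (1 + ((M \ {s(x κ, x' κ), s(y κ, y' κ)}).filter fun e => cutCount U e = 1).card) = 1 ∧
          ((M \ {s(x κ, x' κ), s(y κ, y' κ)}).filter fun e => cutCount U e = 2).card = l) = ∅ :=
      filter_eq_empty_iff.2 fun U _ h => by omega
    rw [hempty, sum_empty, mul_zero, sub_zero]
    -- the first is the tight class `#in' = l - 1` of the reduced instance
    have hcongr : (S \ {x κ, x' κ, y κ, y' κ}).powerset.filter (fun U =>
        ((M \ {s(x κ, x' κ), s(y κ, y' κ)}).filter fun e => cutCount U e = 1).card = 1 ∧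
          1 + ((M \ {s(x κ, x' κ), s(y κ, y' κ)}).filter fun e => cutCount U e = 2).card = l) =
        (S \ {x κ, x' κ, y κ, y' κ}).powerset.filter (fun U =>
        ((M \ {s(x κ, x' κ), s(y κ, y' κ)}).filter fun e => cutCount U e = 1).card = 1 ∧
          ((M \ {s(x κ, x' κ), s(y κ, y' κ)}).filter fun e => cutCount U e = 2).card = l - 1) :=
      filter_congr fun U _ => by omega
    rw [hcongr]
    obtain ⟨hxr, hyr⟩ := aligned_restrict x x' y y' κ hx' hy' hxinj' hyinj' hxy'
    -- the reduced instance is a perfect matching of the reduced vertex set (as in `aligned_level_sum_succ`)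
    have hex : s(x κ, x' κ) ∈ M := hx' κ le_rfl
    have hey : s(y κ, y' κ) ∈ M := hy' κ le_rfl
    have hne : s(x κ, x' κ) ≠ s(y κ, y' κ) := hxy' κ le_rfl κ le_rfl
    have hxx' : x κ ≠ x' κ := fun h => hM.not_isDiag hex (Sym2.mk_isDiag_iff.2 h)
    have hyy' : y κ ≠ y' κ := fun h => hM.not_isDiag hey (Sym2.mk_isDiag_iff.2 h)
    have hxy1 : x κ ≠ y κ := fun h => hne (hM.unique hex hey (Sym2.mem_mk_left _ _) (h ▸ Sym2.mem_mk_left _ _))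
    have hxy2 : x κ ≠ y' κ :=
      fun h => hne (hM.unique hex hey (Sym2.mem_mk_left _ _) (h ▸ Sym2.mem_mk_right _ _))
    have hx'y : x' κ ≠ y κ :=
      fun h => hne (hM.unique hex hey (Sym2.mem_mk_right _ _) (h ▸ Sym2.mem_mk_left _ _))
    have hx'y' : x' κ ≠ y' κ :=
      fun h => hne (hM.unique hex hey (Sym2.mem_mk_right _ _) (h ▸ Sym2.mem_mk_right _ _))
    have hQS : ({x κ, x' κ, y κ, y' κ} : Finset V) ⊆ S := by
      intro w hw
      simp only [mem_insert, mem_singleton] at hw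
      rcases hw with rfl | rfl | rfl | rfl
      · exact hM.mem_of_mem hex (Sym2.mem_mk_left _ _)
      · exact hM.mem_of_mem hex (Sym2.mem_mk_right _ _)
      · exact hM.mem_of_mem hey (Sym2.mem_mk_left _ _)
      · exact hM.mem_of_mem hey (Sym2.mem_mk_right _ _)
    have hQM : IsPMOn ({x κ, x' κ, y κ, y' κ} : Finset V) {s(x κ, x' κ), s(y κ, y' κ)} := by
      have h1 := (IsPMOn.pair hxx').union (IsPMOn.pair hyy')
        (by simp [hxy1.symm, hxy2.symm, hx'y.symm, hx'y'.symm])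
      have e1 : ({x κ, x' κ} : Finset V) ∪ {y κ, y' κ} = {x κ, x' κ, y κ, y' κ} := by
        ext w; simp only [mem_union, mem_insert, mem_singleton]; tauto
      have e2 : ({s(x κ, x' κ)} : Finset (Sym2 V)) ∪ {s(y κ, y' κ)} = {s(x κ, x' κ), s(y κ, y' κ)} := by
        ext e; simp
      rwa [e1, e2] at h1
    have hM' : IsPMOn (S \ {x κ, x' κ, y κ, y' κ}) (M \ {s(x κ, x' κ), s(y κ, y' κ)}) := by
      have h' : IsPMOn (({x κ, x' κ, y κ, y' κ} : Finset V) ∪ (S \ {x κ, x' κ, y κ, y' κ})) M := by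
        rw [union_sdiff_of_subset hQS]; exact hM
      exact h'.sdiff disjoint_sdiff hQM (by
        intro e he
        simp only [mem_insert, mem_singleton] at he
        rcases he with rfl | rfl
        · exact hex
        · exact hey)
    rw [ih hM' hxr hyr (fun j hj j' hj' => hxinj j (by omega) j' (by omega))
      (fun j hj j' hj' => hyinj j (by omega) j' (by omega)) (fun j hj j' hj' => hxy j (by omega) j' (by omega))
      (l - 1) (by omega), card_sdiff_pair x x' y y' κ hx' hy' hxy']
    have e1 : M.card - 2 - 2 * κ = M.card - 2 * (κ + 1) := by omega
    have e2 : l - 1 - κ = l - (κ + 1) := by omega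
    rw [e1, e2, pow_succ]
    ring

end Aligned



end Summit.PneNP.PneNP.Theorems.ChebyshevTracialDesignAlignedDipoleRecursion
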